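import Summits.HodgeConjecture.FermatCycles.ShiodaConditionFourfoldEightySevenA
import HarnessLib

/-!
# Shioda's condition `(P⁴₈₇)` for the Fermat fourfold of degree `87`, kernel-checked — part B and the theorem

HONEST FRAMING: explicit algebraic cycles for specific Hodge classes on Fermat/Delsarte varieties;
residual open instances listed; no claim on general Hodge.

Cell `pub-hfermat`, topic path `Summits/HodgeConjecture/FermatCycles/` (new work, not literature). By the unit-normalised sound search of
`ShiodaConditionFourfoldNormalized.lean` (`shiodaConditionUpTo_four_of_normalized`): case U (`1 ∈ s`) in chunks `b ∈ [1, 12)`, `[12, 21)`, `[21, 31)`, `[31, 87)`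
(64 614 + 63 236 + 65 078 + 40 260 sorted tuples) and case N (all six entries among the `30` non-units of `ℤ/87`, 29 645 tuples), each by
`decide +kernel`; cross-checked by `code/lit/p39/proto_norm.py 87` (1018 + 680 Hodge multisets; 1016 + 680 carry a pair `{a, −a}`, 2 are
quasi-decomposable, 0 semi-only, 0 failures) and by the cell's P4-TABLE (two implementations + referee). `87 = 3·29` is one of the six
degrees `39, 51, 57, 69, 87, 93 ≤ 100` at which the cell's enumeration finds `(P⁴ₘ)` TRUE while refereed print neither verifies `(P⁴ₘ)`
(verified: `m` prime or `m ≤ 20`, all `n`, and `m = 21`, `n ≤ 10` [Shioda1979PJA, §2]; `m = 21, 27`, all `n` [daSilva2021HodgeFermat, Thm 3.3])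
nor proves HC(X⁴ₘ) otherwise (`3 ∣ m`: outside [daSilva2021HodgeFermat, Prop. 3.1], `m ≤ 100` coprime to `6`; outside Aoki's `pᵉ`, `2pᵉ` and
`{2,3,5,7}`-smooth degrees). PUBLIC PRIORITY: the computer-assisted preprint [Jumagulov2026OddFermatFourfolds] (arXiv:2608.18134, July 2026)
asserts HC(X⁴ₘ) for every odd `m ≤ 199` (its Thm 1.1) through a census of the Galois orbits of Hodge (2,2) characters (its Thm 1.5) whose
Appendix C row `m = 87` — 570 orbits = 569 decomposable + 1 quasi-decomposable + 0 other — is `(P⁴₈₇)`; the cell reproduces that row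
by two independent enumerations (`code/lit/census/orbits.py --method norm | brute`). This file is an INDEPENDENT certificate of `(P⁴₈₇)`
checked by the Lean kernel, not a first claim.
Part A (`ShiodaConditionFourfoldEightySevenA.lean`) holds the case-U chunks with `b < 21`; this part B the chunks `b ≥ 21`
(65 078 + 40 260 tuples), case N, and **`shiodaConditionUpTo_eightySeven_four : ShiodaConditionUpTo 87 4`**.

References: [Shioda1979PJA] T. Shioda, Proc. Japan Acad. 55A (1979) §1 (condition (Pⁿₘ)), §2 Thm 1; [daSilva2021HodgeFermat]
G. da Silva Jr., Experimental Results 2 (2021) e22, Def. 2.4, Prop. 3.1, Thm 3.3; [Jumagulov2026OddFermatFourfolds] R. Jumagulov,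
arXiv:2608.18134 (preprint, July 2026), Thm 1.1, Thm 1.5, Appendix C.
-/

namespace Summit.HodgeConjecture.FermatCycles.ShiodaConditionFourfold

open Multiset
open Literature.AlgebraicGeometry.HodgeTheory Literature.AlgebraicGeometry.HodgeTheory.FermatCharacter


set_option maxHeartbeats 0 in
/-- Case U at `N = 87`, `b ∈ [21, 31)` (65 078 tuples). Kernel. [cite: Shioda1979PJA, §1 condition (Pⁿₘ), n = 4] -/
theorem checkU_87_21 : checkU 87 21 10 = true := by decide +kernel

set_option maxHeartbeats 0 in
/-- Case U at `N = 87`, `b ∈ [31, 87)` (40 260 tuples). Kernel. [cite: Shioda1979PJA, §1 condition (Pⁿₘ), n = 4] -/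
theorem checkU_87_31 : checkU 87 31 56 = true := by decide +kernel

set_option maxHeartbeats 0 in
/-- Case N at `N = 87` (sorted `6`-tuples of the `30` non-units; 29 645 tuples). Kernel. [cite: Shioda1979PJA, §1 condition (Pⁿₘ), n = 4] -/
theorem checkNU_87 : checkNU 87 = true := by decide +kernel

/-- **`(P⁴₈₇)` holds**: every Hodge `6`-multiset over `ℤ/87` (every Hodge character of `X⁴₈₇` up to permutation) is decomposable,
quasi-decomposable or semi-decomposable — the arithmetic hypothesis of Shioda's Theorem 1 for `X⁴₈₇`, a degree covered by no
refereed theorem (public priority: the census of the preprint [Jumagulov2026OddFermatFourfolds, Thm 1.5, App. C]); certified by the cell's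
enumeration (P4-TABLE) and here, independently, by the kernel through the unit-normalised search.
[cite: Shioda1979PJA, §1 condition (Pⁿₘ) and §2 Thm 1] -/
theorem shiodaConditionUpTo_eightySeven_four : ShiodaConditionUpTo 87 4 :=
  haveI : Fact (1 < 87) := ⟨by norm_num⟩
  shiodaConditionUpTo_four_of_normalized 87 [(1, 11), (12, 9), (21, 10), (31, 56)]
    (by
      intro b hb0 hb
      rcases Nat.lt_or_ge b 12 with h1 | h1
      · exact ⟨(1, 11), by simp, by omega, by omega⟩
      · rcases Nat.lt_or_ge b 21 with h2 | h2
        · exact ⟨(12, 9), by simp, h1, by omega⟩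
        · rcases Nat.lt_or_ge b 31 with h3 | h3
          · exact ⟨(21, 10), by simp, h2, by omega⟩
          · exact ⟨(31, 56), by simp, h3, by omega⟩)
    (by
      intro p hp
      simp only [List.mem_cons, List.not_mem_nil, or_false] at hp
      rcases hp with rfl | rfl | rfl | rfl
      · exact checkU_87_1
      · exact checkU_87_12
      · exact checkU_87_21
      · exact checkU_87_31)
    checkNU_87

/-- Consequence in the tree's currency: every Shioda-closed family of cycle characters mod `87` contains every Hodge character of
`X⁴₈₇`. [cite: Shioda1979PJA, §2 Thm 1 and §4] -/
theorem forall_of_isShiodaClosed_eightySeven {C : Multiset (ZMod 87) → Prop} (hC : IsShiodaClosed C)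
    (s : Multiset (ZMod 87)) (hs : IsHodgeMultiset s) (h0 : s ≠ 0) (h6 : card s ≤ 6) : C s :=
  hC.of_shiodaConditionUpTo shiodaConditionUpTo_eightySeven_four s h0 hs h6

end Summit.HodgeConjecture.FermatCycles.ShiodaConditionFourfold
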